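import Summits.QuantumFields.YangMills.Theorems.BalabanLadderUVSeamRecCeilingsResponseCarriersLevelwise
import Summits.QuantumFields.YangMills.Theorems.BalabanLadderUVSeamRecCeilingsSeamReduction
import Summits.QuantumFields.YangMills.Theorems.BalabanLadderUVSeamRecCeilingsLevelZeroLaw
import Summits.QuantumFields.YangMills.Theorems.BalabanLadderUVSeamRecPolymerCarrierLevels
import HarnessLib

/-!
# Crux `UVSeamRec` (stmt-QuantumFields-20043), v5(α) stub `stub_responseMomentsOdd6` (RM): the large-field half of the (β) architecture on ALL
# odd tori from WINDOW CELL LAWS — per-level product laws for grid-aligned block-plaquettes that do NOT WRAP the torus — at the cost `δ_k^{1/16}`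

Helper file (`--supports stmt-QuantumFields-20043`) of the width-lever seat `ym-20043-ceilings-p2` (lane B, gen 3); assembles this seat's
`…CeilingsSeamReduction` (the (RM) body sees cube centres only mod the period ⇒ carrier moments are needed for REDUCED families only),
`…CeilingsResponseCarriersLevelwise` (p550081: per-level period-free laws + total budget ⇒ doubled joint moments, same constants),
`…CeilingsLevelZeroLaw` (the proved period-free level-`0` law) and tempered-d1's `…PolymerCarrierLevels` (p545222: per-level budget
`Σ_γ familyCoeff·w(γ.k) ≤ 1536·Σ_k w k`).

THE SEAM (tempered-d1's located remark in p541348; this seat's note §7).  D1's block-plaquettes live on the GLOBAL grids `b^kℤ⁴`; on a torus of side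
`2L+1` with `b^k ∤ 2L+1` the shells of two cubes that are close ACROSS the period read the grid through representatives differing by a period, i.e.
through grids MISALIGNED by `(2L+1) mod b^k`: distinct same-level block-plaquettes with heavily OVERLAPPING torus footprints, for which no product law
with small weights holds.  So every product-law hypothesis over (sub)families of the family shell (p543486, p547375, p550081, family-free cell laws)
is unsatisfiable with β-uniform budgets at levels `k ≥ 1` on such tori UNLESS the conflicts are quarantined.  THE CURE (no re-typing of the carrier):
(1) by `…SeamReduction` only REDUCED families (`|x_i| ≤ L`) need carrier moments; (2) for a reduced family the anchors of its level-`k` shell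
polymers lie in `[−L−2R−2, L+2R+2]⁴`, and two of them can conflict (overlap without coinciding on the torus) only if their anchors have OPPOSITE
signs in some coordinate; so each of the `16` SIGN CLASSES is a family of grid blocks inside ONE period window (no wrap), where torus footprints
overlap iff the blocks coincide; (3) a WINDOW CELL LAW — `⟨∏_{γ∈A} 1_{E_γ}∘lift⟩ ≤ δ_k^{#A}` for finite families `A` of level-`k` block-plaquettes
whose footprints `[b^k y, b^k y + b^k)` fit in a common period window `[o, o + 2L+1)⁴` — is the honest single-scale supplier target (exactly the
divisible-torus statement, askable on every torus); (4) for an arbitrary subfamily `A` of the level-`k` shell, keep the LARGEST sign class `A_s`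
(`16·#A_s ≥ #A`), drop the other indicators (`≤ 1`), and get `≤ δ_k^{#A_s} ≤ θ_k^{#A}` with `θ_k := δ_k^{1/16}` — so the weights of p550081 are
`θ_k`, and the budget is β-uniform iff `Σ_{1≤k≤kmax} δ_k^{1/16}` is (for Bałaban-kind `δ_k = e^{−p₀(g_k)}` a factor `16` in the exponent).

* §1 `torusE_prod_indicator_anti` (dropping indicators), `exists_signClass` (pigeonhole on `Fin 4 → Bool`), `anchor_window_of_signClass`.
* §2 `torusE_exp_two_mul_sum_influence_le_of_windowCellLaws` — REDUCED separated family, window cell laws at the levels `k ≥ 1` with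
  `δ_k ≤ θ_k^16`, `0 ≤ θ_k ≤ 1`: `⟨exp(2Σ_i influence∘lift)⟩ ≤ exp(2e²·1536·(δ₀(β) + Σ_{1≤k≤kmax} θ_k)·#T)`, `δ₀(β)` the PROVED level-`0` activity.
* §3 `responseMoments_of_quadratic_and_windowCellLaws` (+ registered twin `responseMomentsOdd6_of_quadratic_and_windowCellLaws`): (split) + (EM_Q) +
  eventual bound `Δ₀` of the level-`0` activity + window cell laws with `Σ_{1≤k≤kmax β R} θ(β,k) ≤ D` ⇒ (RM) on ALL families of ALL odd tori,
  `B = A₀ + max(B_Q, 2e²·1536·(Δ₀ + D))`.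
HONEST FRAMING: composition; (split), (EM_Q) and the window cell laws at levels `k ≥ 1` are OPEN renormalisation-group statements (Bałaban-type
large-field estimates, one scale at a time, no RP, no divisibility); nothing of E0′; not a gap, not Clay.
References: folklore; T. Bałaban, Commun. Math. Phys. 122 (1989) 355–392 (intended supplier of the window cell laws).
-/

set_option autoImplicit false

noncomputable section

open MeasureTheory Filter Topology Finset
open Literature.Probability.LatticeModels
open Literature.MathematicalPhysics.QuantumFieldTheory (GaugeConfig wilsonMeasure isProbabilityMeasure_wilsonMeasure
  measurable_torusLift LatticeRep)
open Literature.MathematicalPhysics.QuantumLattice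

namespace Summit.QuantumFields.YangMills.Cruxes.UVSeamRec.TemperedResponse

open Summit.QuantumFields.YangMills.Cruxes.OSLegsFromFemtoAndGap.DlrCollarTransfer
open Summit.QuantumFields.YangMills.Cruxes.UVSeamRec.PolymerData
open Summit.QuantumFields.YangMills.Theorems.OddTorusChessboard (Orient)

/-! ## §1 Dropping indicators; sign classes of a reduced family -/

section SignClasses

variable {G : Type} [Group G] [TopologicalSpace G] [IsTopologicalGroup G] [CompactSpace G]
  [MeasurableSpace G] [BorelSpace G] (r : LatticeRep G)

/-- Dropping indicator factors (`∈ [0,1]`) increases a torus expectation of a product of indicators: `A' ⊆ A ⇒ ⟨∏_A 1_E⟩ ≤ ⟨∏_{A'} 1_E⟩`.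
[folklore] -/
theorem torusE_prod_indicator_anti (β : ℝ) (L : ℕ) {κ : Type} (E : κ → Set (LGConfig 4 G)) (hE : ∀ γ, MeasurableSet (E γ))
    {A A' : Finset κ} (h : A' ⊆ A) :
    torusE G r β L (fun U => ∏ γ ∈ A, (E γ).indicator (fun _ => (1 : ℝ)) U) ≤
      torusE G r β L (fun U => ∏ γ ∈ A', (E γ).indicator (fun _ => (1 : ℝ)) U) := by
  classical
  haveI := isProbabilityMeasure_wilsonMeasure (d := 4) (L := 2 * L + 1) r.ρ r.continuous β
  have hχ0 : ∀ γ (η : LGConfig 4 G), 0 ≤ (E γ).indicator (fun _ => (1 : ℝ)) η := fun γ η =>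
    Set.indicator_nonneg (fun _ _ => zero_le_one) _
  have hχ1 : ∀ γ (η : LGConfig 4 G), (E γ).indicator (fun _ => (1 : ℝ)) η ≤ 1 := fun γ η =>
    Set.indicator_apply_le' (fun _ => le_rfl) (fun _ => zero_le_one)
  have hpt : ∀ η : LGConfig 4 G, ∏ γ ∈ A, (E γ).indicator (fun _ => (1 : ℝ)) η ≤ ∏ γ ∈ A', (E γ).indicator (fun _ => (1 : ℝ)) η := by
    intro η
    rw [← Finset.prod_sdiff h]
    calc (∏ γ ∈ A \ A', (E γ).indicator (fun _ => (1 : ℝ)) η) * ∏ γ ∈ A', (E γ).indicator (fun _ => (1 : ℝ)) η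
        ≤ 1 * ∏ γ ∈ A', (E γ).indicator (fun _ => (1 : ℝ)) η :=
          mul_le_mul_of_nonneg_right (Finset.prod_le_one (fun γ _ => hχ0 γ η) fun γ _ => hχ1 γ η)
            (Finset.prod_nonneg fun γ _ => hχ0 γ η)
      _ = _ := one_mul _
  have hmeas : ∀ B : Finset κ, Measurable fun U : GaugeConfig 4 (2 * L + 1) G =>
      ∏ γ ∈ B, (E γ).indicator (fun _ => (1 : ℝ)) (torusLift (2 * L + 1) U) := fun B =>
    Finset.measurable_prod B fun γ _ => (measurable_const.indicator (hE γ)).comp (measurable_torusLift _)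
  have hint : Integrable (fun U : GaugeConfig 4 (2 * L + 1) G =>
      ∏ γ ∈ A', (E γ).indicator (fun _ => (1 : ℝ)) (torusLift (2 * L + 1) U)) (wilsonMeasure (d := 4) (L := 2 * L + 1) r.ρ β) := by
    refine integrable_of_abs_le (hmeas A') (C := 1) fun U => ?_
    rw [abs_of_nonneg (Finset.prod_nonneg fun γ _ => hχ0 γ _)]
    exact Finset.prod_le_one (fun γ _ => hχ0 γ _) fun γ _ => hχ1 γ _
  unfold torusE
  exact integral_mono_of_nonneg (ae_of_all _ fun U => Finset.prod_nonneg fun γ _ => hχ0 γ _) hint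
    (ae_of_all _ fun U => hpt _)

/-- Pigeonhole on the `16` sign vectors: every finite family of polymers has a sign class — the members whose anchors have a prescribed sign
pattern — with at least one sixteenth of the members. [folklore] -/
theorem exists_signClass (𝔟 : BlockSize) (A : Finset Polymer) :
    ∃ s : Fin 4 → Bool, A.card ≤ 16 * (A.filter (fun γ => (fun c => decide (0 ≤ anchor 𝔟 γ c)) = s)).card := by
  classical
  have hsum : ∑ s : Fin 4 → Bool, (A.filter (fun γ => (fun c => decide (0 ≤ anchor 𝔟 γ c)) = s)).card = A.card :=
    (Finset.card_eq_sum_card_fiberwise (f := fun γ => fun c => decide (0 ≤ anchor 𝔟 γ c)) (s := A) (t := Finset.univ)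
      fun γ _ => Finset.mem_univ _).symm
  have hcard : (Finset.univ : Finset (Fin 4 → Bool)).card = 16 := by simp
  by_contra hcon
  have hcon' : ∀ s : Fin 4 → Bool, 16 * (A.filter (fun γ => (fun c => decide (0 ≤ anchor 𝔟 γ c)) = s)).card < A.card :=
    fun s => lt_of_not_ge fun h => hcon ⟨s, h⟩
  have hlt : ∑ s : Fin 4 → Bool, 16 * (A.filter (fun γ => (fun c => decide (0 ≤ anchor 𝔟 γ c)) = s)).card <
      ∑ _s : Fin 4 → Bool, A.card := Finset.sum_lt_sum_of_nonempty Finset.univ_nonempty fun s _ => hcon' s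
  rw [← Finset.mul_sum, hsum, Finset.sum_const, hcard, smul_eq_mul] at hlt
  exact lt_irrefl _ hlt

/-- **The sign classes of a REDUCED family do not wrap.**  If `|x i c| ≤ L` for all `i, c`, `4R+8 ≤ L`, and `γ` is a polymer of the family shell
whose anchor has sign pattern `s`, then with the window origin `o_c = 0` (if `s c`) resp. `o_c = −(L+2R+2)` (if `¬ s c`) its footprint fits in the
period window: `o_c ≤ b^k y_c` and `b^k y_c + b^k ≤ o_c + (2L+1)`. [folklore] -/
theorem anchor_window_of_signClass (𝔟 : BlockSize) (kmax R L : ℕ) (hRL : 4 * R + 8 ≤ L) {n : ℕ} (x : Fin n → (Fin 4 → ℤ))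
    (hred : ∀ i c, |x i c| ≤ (L : ℤ)) {γ : Polymer} (hγ : γ ∈ familyShell 𝔟 kmax R x) (s : Fin 4 → Bool)
    (hs : (fun c => decide (0 ≤ anchor 𝔟 γ c)) = s) (c : Fin 4) :
    (if s c then (0 : ℤ) else -((L : ℤ) + 2 * R + 2)) ≤ anchor 𝔟 γ c ∧
      anchor 𝔟 γ c + (𝔟.b : ℤ) ^ γ.k ≤ (if s c then (0 : ℤ) else -((L : ℤ) + 2 * R + 2)) + (2 * L + 1) := by
  obtain ⟨i, _, hi⟩ := Finset.mem_biUnion.1 hγ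
  have hshell := (mem_shell_iff 𝔟 kmax R (x i) γ).1 hi
  have hd : ((x i c - anchor 𝔟 γ c).natAbs : ℤ) ≤ ((2 * R + 2 : ℕ) : ℤ) := by
    exact_mod_cast (PolymerData.natAbs_sub_le_supDist (x i) (anchor 𝔟 γ) c).trans hshell.2.2
  rw [Int.natCast_natAbs] at hd
  push_cast at hd
  have hx := abs_le.1 (hred i c)
  have ha := abs_le.1 hd
  have hbk : (𝔟.b : ℤ) ^ γ.k ≤ R := by
    have h2 : 2 * 𝔟.b ^ γ.k ≤ R := by have := hshell.2.1.trans hshell.2.2; omega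
    have : ((𝔟.b ^ γ.k : ℕ) : ℤ) ≤ R := by exact_mod_cast (Nat.le_of_lt_succ (by omega : 𝔟.b ^ γ.k < R + 1))
    push_cast at this
    exact this
  have hL : (4 * (R : ℤ) + 8) ≤ L := by exact_mod_cast hRL
  have hsc : s c = decide (0 ≤ anchor 𝔟 γ c) := by rw [← hs]
  by_cases h0 : 0 ≤ anchor 𝔟 γ c
  · have : s c = true := by rw [hsc]; exact decide_eq_true h0
    simp only [this, if_true]
    constructor <;> linarith
  · have : s c = false := by rw [hsc]; exact decide_eq_false h0
    have h0' : anchor 𝔟 γ c < 0 := lt_of_not_ge h0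
    simp only [this, Bool.false_eq_true, if_false]
    constructor <;> linarith

end SignClasses

/-! ## §2 The doubled joint exponential moments of the influence functionals of a REDUCED family from window cell laws -/

section Window

variable {N : ℕ} [NeZero N]

/-- **DOUBLED JOINT EXPONENTIAL MOMENTS FROM WINDOW CELL LAWS (reduced families).**  Fundamental Wilson state of `SU(N)` on the odd torus `2L+1`,
`β ≥ 1`; a REDUCED cube family (`|x i c| ≤ L`) pairwise cyclically `2R+4`-separated with `1 ≤ R`, `4R+8 ≤ L`; block size `𝔟`, thresholds `ε`,
cutoff `kmax`.  Level weights `θ k ∈ [0,1]` and activities `δ k ≤ (θ k)^16` for `k ≥ 1` with the WINDOW CELL LAWS: for every `k ≥ 1`, every window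
origin `o` and every finite family `A` of level-`k` block-plaquettes whose footprints fit in the period window `[o, o+2L+1)⁴`,
`⟨∏_{γ∈A} 1_{largeFieldEvent 𝔟 (ε k) γ}∘lift⟩ ≤ ∏_{γ∈A} δ k`.  THEN, with the constants `K₀, D₁` of the proved level-`0` law,
`⟨exp(2 Σ_{i∈T} influence 𝔟 ε kmax R (x i)∘lift)⟩_{2L+1,β} ≤ exp(2e²·1536·(δ₀ + Σ_{1 ≤ k ≤ kmax} θ k)·#T)`,
`δ₀ = exp(−βNε₀/#Orient + (K₀ + D₁ log β)/#Orient)`. [folklore] -/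
theorem torusE_exp_two_mul_sum_influence_le_of_windowCellLaws :
    ∃ K₀ : ℝ, ∃ D₁ : ℕ, ∀ (𝔟 : BlockSize) (ε : ℕ → ℝ) (kmax R L : ℕ) (β : ℝ), 1 ≤ β → ∀ {n : ℕ} (x : Fin n → (Fin 4 → ℤ)),
      1 ≤ R → 4 * R + 8 ≤ L → (∀ i c, |x i c| ≤ (L : ℤ)) →
      (∀ i j : Fin n, i ≠ j → ∃ k : Fin 4,
        (2 * (R : ℤ) + 4) ≤ |((((x i k - x j k : ℤ) : ZMod (2 * L + 1))).valMinAbs : ℤ)|) →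
      ∀ (θ δ : ℕ → ℝ), (∀ k, 0 ≤ θ k) → (∀ k, θ k ≤ 1) → (∀ k, 0 ≤ δ k) → (∀ k, δ k ≤ θ k ^ 16) →
      (∀ k : ℕ, 1 ≤ k → ∀ (o : Fin 4 → ℤ) (A : Finset Polymer), (∀ γ ∈ A, γ.k = k) →
        (∀ γ ∈ A, ∀ c, o c ≤ anchor 𝔟 γ c ∧ anchor 𝔟 γ c + (𝔟.b : ℤ) ^ k ≤ o c + (2 * L + 1)) →
        torusE (Matrix.specialUnitaryGroup (Fin N) ℂ) (fundamentalLatticeRep N) β L (fun U => ∏ γ ∈ A,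
          (largeFieldEvent (N := N) 𝔟 (ε k) γ).indicator (fun _ => (1 : ℝ)) U) ≤ ∏ _γ ∈ A, δ k) →
      ∀ T : Finset (Fin n),
        torusE (Matrix.specialUnitaryGroup (Fin N) ℂ) (fundamentalLatticeRep N) β L
            (fun U => Real.exp (((2 : ℕ) : ℝ) * ∑ i ∈ T, influence (N := N) 𝔟 ε kmax R (x i) U)) ≤
          Real.exp (2 * Real.exp (2 * 1) * (1536 * (Real.exp (-(β * ((N : ℝ) * ε 0)) / Fintype.card (Orient 4) +
            (K₀ + D₁ * Real.log β) / Fintype.card (Orient 4)) +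
            ∑ k ∈ (Finset.range (kmax + 1)).filter (fun k => 1 ≤ k), θ k)) * T.card) := by
  classical
  obtain ⟨K₀, D₁, hPL0⟩ := torusE_prod_indicator_levelZero_le (N := N)
  refine ⟨K₀, D₁, ?_⟩
  intro 𝔟 ε kmax R L β hβ n x hR hRL hred hsep θ δ hθ0 hθ1 hδ0 hδθ hWCL T
  have hL : 1 ≤ L := by omega
  set δ₀ : ℝ := Real.exp (-(β * ((N : ℝ) * ε 0)) / Fintype.card (Orient 4) + (K₀ + D₁ * Real.log β) / Fintype.card (Orient 4))
    with hδ₀def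
  have hδ₀0 : 0 ≤ δ₀ := (Real.exp_pos _).le
  -- level weights: the proved level-0 activity at level 0, `θ k` above
  set W : ℕ → ℝ := fun k => if k = 0 then δ₀ else θ k with hWdef
  have hW0 : ∀ k, 0 ≤ W k := fun k => by
    by_cases hk : k = 0
    · simp only [hWdef, hk, if_true]; exact hδ₀0
    · simp only [hWdef, hk, if_false]; exact hθ0 k
  set fS := familyShell 𝔟 kmax R x with hfS
  -- the levelwise composition with weights `w γ = W γ.k`
  have key := torusE_exp_two_mul_sum_influence_le_of_levelwise (N := N) (fundamentalLatticeRep N) 𝔟 ε kmax R L β x hRL hsep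
    (W := 1536 * (δ₀ + ∑ k ∈ (Finset.range (kmax + 1)).filter (fun k => 1 ≤ k), θ k))
    (fun γ => W γ.k) (fun γ _ => hW0 γ.k) ?_ ?_ T
  · simpa only [hδ₀def] using key
  · -- the budget: tempered-d1's per-level count
    intro i
    refine (sum_familyCoeff_mul_level_weight_le 𝔟 kmax R x i W hW0).trans (le_of_eq ?_)
    congr 1
    rw [← Finset.sum_filter_add_sum_filter_not (Finset.range (kmax + 1)) (fun k => k = 0)]
    have h0 : ∑ k ∈ (Finset.range (kmax + 1)).filter (fun k => k = 0), W k = δ₀ := by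
      have : (Finset.range (kmax + 1)).filter (fun k => k = 0) = {0} := by
        ext k
        simp only [Finset.mem_filter, Finset.mem_range, Finset.mem_singleton]
        constructor
        · exact fun h => h.2
        · intro h; subst h; exact ⟨Nat.succ_pos _, rfl⟩
      rw [this, Finset.sum_singleton]
      simp only [hWdef, if_true]
    have h1 : ∑ k ∈ (Finset.range (kmax + 1)).filter (fun k => ¬ k = 0), W k =
        ∑ k ∈ (Finset.range (kmax + 1)).filter (fun k => 1 ≤ k), θ k := by
      have : (Finset.range (kmax + 1)).filter (fun k => ¬ k = 0) = (Finset.range (kmax + 1)).filter (fun k => 1 ≤ k) :=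
        Finset.filter_congr fun k _ => Nat.one_le_iff_ne_zero.symm
      rw [this]
      refine Finset.sum_congr rfl fun k hk => ?_
      have hk1 : ¬ k = 0 := Nat.one_le_iff_ne_zero.1 (Finset.mem_filter.1 hk).2
      simp only [hWdef, hk1, if_false]
    rw [h0, h1]
  · -- the per-level laws
    intro k A hA hinj
    have hAk : ∀ γ ∈ A, γ.k = k := fun γ hγ => (Finset.mem_filter.1 (hA hγ)).2
    have hlhs : (fun U => ∏ γ ∈ A, (largeFieldEvent (N := N) 𝔟 (ε γ.k) γ).indicator (fun _ => (1 : ℝ)) U) =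
        fun U => ∏ γ ∈ A, (largeFieldEvent (N := N) 𝔟 (ε k) γ).indicator (fun _ => (1 : ℝ)) U := by
      funext U
      exact Finset.prod_congr rfl fun γ hγ => by rw [hAk γ hγ]
    have hrhs : ∏ γ ∈ A, W γ.k = ∏ _γ ∈ A, W k := Finset.prod_congr rfl fun γ hγ => by rw [hAk γ hγ]
    rw [hlhs, hrhs]
    by_cases hk : k = 0
    · -- level 0: the proved law (period-free families)
      subst hk
      have h := hPL0 𝔟 (ε 0) L hL β hβ A hAk hinj
      simpa only [hWdef, if_true, hδ₀def] using h
    · -- level k ≥ 1: the largest sign class does not wrap; window cell law; δ ≤ θ^16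
      have hk1 : 1 ≤ k := Nat.one_le_iff_ne_zero.2 hk
      simp only [hWdef, hk, if_false, Finset.prod_const]
      obtain ⟨s, hs⟩ := exists_signClass 𝔟 A
      set A' := A.filter (fun γ => (fun c => decide (0 ≤ anchor 𝔟 γ c)) = s) with hA'
      have hA'sub : A' ⊆ A := Finset.filter_subset _ _
      set o : Fin 4 → ℤ := fun c => if s c then (0 : ℤ) else -((L : ℤ) + 2 * R + 2) with ho
      have hwin : ∀ γ ∈ A', ∀ c, o c ≤ anchor 𝔟 γ c ∧ anchor 𝔟 γ c + (𝔟.b : ℤ) ^ k ≤ o c + (2 * L + 1) := by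
        intro γ hγ c
        have h1 := Finset.mem_filter.1 hγ
        have hγk : γ.k = k := hAk γ h1.1
        have hw := anchor_window_of_signClass 𝔟 kmax R L hRL x hred (Finset.mem_filter.1 (hA h1.1)).1 s h1.2 c
        rw [hγk] at hw
        simpa only [ho] using hw
      have hcell := hWCL k hk1 o A' (fun γ hγ => hAk γ (hA'sub hγ)) hwin
      calc torusE (Matrix.specialUnitaryGroup (Fin N) ℂ) (fundamentalLatticeRep N) β L (fun U => ∏ γ ∈ A,
              (largeFieldEvent (N := N) 𝔟 (ε k) γ).indicator (fun _ => (1 : ℝ)) U)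
          ≤ torusE (Matrix.specialUnitaryGroup (Fin N) ℂ) (fundamentalLatticeRep N) β L (fun U => ∏ γ ∈ A',
              (largeFieldEvent (N := N) 𝔟 (ε k) γ).indicator (fun _ => (1 : ℝ)) U) :=
            torusE_prod_indicator_anti (fundamentalLatticeRep N) β L _ (fun γ => measurableSet_largeFieldEvent (N := N) 𝔟 _ γ) hA'sub
        _ ≤ ∏ _γ ∈ A', δ k := hcell
        _ = δ k ^ A'.card := Finset.prod_const _
        _ ≤ (θ k ^ 16) ^ A'.card := pow_le_pow_left₀ (hδ0 k) (hδθ k) _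
        _ = θ k ^ (16 * A'.card) := by rw [← pow_mul]
        _ ≤ θ k ^ A.card := pow_le_pow_of_le_one (hθ0 k) (hθ1 k) hs

end Window

/-! ## §3 (RM) on ALL families of ALL odd tori from (split) + (EM_Q) + window cell laws -/

section Button

variable {N : ℕ} [NeZero N]

/-- **(RM) FROM THE (β) SPLIT, (EM_Q) AND WINDOW CELL LAWS AT THE LEVELS `k ≥ 1`.**  Fundamental representation of `SU(N)`, any unit `a`; block size `𝔟`,
thresholds `ε β k`, cutoff `kmax β R`.  Hypotheses: (split) for all exteriors against `A₀ + Q + influenceAt 𝔟 ε kmax`; (EM_Q); the eventual bound `Δ₀`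
of the PROVED level-`0` activity (for all `K₀, D₁`; true for thresholds `ε(β,0) ≥ ε₀ > 0`); level weights `θ β k ∈ [0,1]` and activities
`0 ≤ δ β k ≤ (θ β k)^16` with the WINDOW CELL LAWS for `β ≥ β₁`, `L ≥ 1`, `k ≥ 1` (families of level-`k` block-plaquettes whose footprints fit in one
period window); and the budget `Σ_{1 ≤ k ≤ kmax β R} θ β k ≤ D` (`β ≥ β₁`, all `R`).  THEN (RM) for `β ≥ β₁'`, on ALL separated families of ALL odd
tori, with `B = A₀ + max(B_Q, 2e²·1536·(Δ₀ + D))`.  Proof: seam reduction to reduced families (`responseMoments_of_quadratic_and_reducedLF`) + §2.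
[folklore] -/
theorem responseMoments_of_quadratic_and_windowCellLaws (a : ℝ → ℝ) (𝔟 : BlockSize) (ε : ℝ → ℕ → ℝ) (kmax : ℝ → ℕ → ℕ)
    {C₁ β₁ ℓ₁ A₀ B_Q D Δ₀ : ℝ} {p : Fin 4 × Fin 4 → ℝ → ℝ}
    (Q : ℝ → ℕ → Fin 4 × Fin 4 → (Fin 4 → ℤ) → LGConfig 4 (Matrix.specialUnitaryGroup (Fin N) ℂ) → ℝ)
    (MQ : ℝ → ℕ → Fin 4 × Fin 4 → (Fin 4 → ℤ) → ℝ)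
    (hQm : ∀ β R q x, Measurable (Q β R q x)) (hQb : ∀ β R q x η, |Q β R q x η| ≤ MQ β R q x)
    (hsplit : ∀ β : ℝ, β₁ ≤ β → ∀ R : ℕ, 1 ≤ R → (R : ℝ) * a β ≤ ℓ₁ →
      ∀ (q : Fin 4 × Fin 4) (x : Fin 4 → ℤ), q.1 < q.2 → ∀ η : LGConfig 4 (Matrix.specialUnitaryGroup (Fin N) ℂ),
        (R : ℝ) ^ 4 / C₁ * |kerE (Matrix.specialUnitaryGroup (Fin N) ℂ) (fundamentalLatticeRep N) β (fun k => x k - (R + 1))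
          (2 * R + 3) η (plane (Matrix.specialUnitaryGroup (Fin N) ℂ) (fundamentalLatticeRep N) q x) - p q β| ≤
          A₀ + Q β R q x η + influenceAt (N := N) 𝔟 ε kmax β R q x η)
    (hEMQ : ∀ β : ℝ, β₁ ≤ β → ∀ (L n : ℕ) (q : Fin n → Fin 4 × Fin 4) (x : Fin n → (Fin 4 → ℤ)) (R : ℕ),
      (∀ i, (q i).1 < (q i).2) → 1 ≤ R → (R : ℝ) * a β ≤ ℓ₁ → 4 * R + 8 ≤ L →
      (∀ i j : Fin n, i ≠ j → ∃ k : Fin 4,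
        (2 * (R : ℤ) + 4) ≤ |((((x i k - x j k : ℤ) : ZMod (2 * L + 1))).valMinAbs : ℤ)|) →
      ∀ T : Finset (Fin n),
        torusE (Matrix.specialUnitaryGroup (Fin N) ℂ) (fundamentalLatticeRep N) β L
          (fun U => Real.exp (((2 : ℕ) : ℝ) * ∑ i ∈ T, Q β R (q i) (x i) U)) ≤ Real.exp (B_Q * T.card))
    (hδ₀ : ∀ (K₀ : ℝ) (D₁ : ℕ), ∃ β₀ : ℝ, ∀ β : ℝ, β₀ ≤ β →
      Real.exp (-(β * ((N : ℝ) * ε β 0)) / Fintype.card (Orient 4) + (K₀ + D₁ * Real.log β) / Fintype.card (Orient 4)) ≤ Δ₀)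
    (θ δ : ℝ → ℕ → ℝ) (hθ0 : ∀ β k, 0 ≤ θ β k) (hθ1 : ∀ β k, θ β k ≤ 1) (hδ0 : ∀ β k, 0 ≤ δ β k)
    (hδθ : ∀ β k, δ β k ≤ θ β k ^ 16)
    (hWCL : ∀ β : ℝ, β₁ ≤ β → ∀ L : ℕ, 1 ≤ L → ∀ k : ℕ, 1 ≤ k → ∀ (o : Fin 4 → ℤ) (A : Finset Polymer),
      (∀ γ ∈ A, γ.k = k) → (∀ γ ∈ A, ∀ c, o c ≤ anchor 𝔟 γ c ∧ anchor 𝔟 γ c + (𝔟.b : ℤ) ^ k ≤ o c + (2 * L + 1)) →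
      torusE (Matrix.specialUnitaryGroup (Fin N) ℂ) (fundamentalLatticeRep N) β L (fun U => ∏ γ ∈ A,
        (largeFieldEvent (N := N) 𝔟 (ε β k) γ).indicator (fun _ => (1 : ℝ)) U) ≤ ∏ _γ ∈ A, δ β k)
    (hD : ∀ β : ℝ, β₁ ≤ β → ∀ R : ℕ, ∑ k ∈ (Finset.range (kmax β R + 1)).filter (fun k => 1 ≤ k), θ β k ≤ D) :
    ∃ β₁' : ℝ, ∀ β : ℝ, β₁' ≤ β → ∀ (L n : ℕ) (q : Fin n → Fin 4 × Fin 4) (x : Fin n → (Fin 4 → ℤ)) (R : ℕ),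
      (∀ i, (q i).1 < (q i).2) → 1 ≤ R → (R : ℝ) * a β ≤ ℓ₁ → 4 * R + 8 ≤ L →
      (∀ i j : Fin n, i ≠ j → ∃ k : Fin 4,
        (2 * (R : ℤ) + 4) ≤ |((((x i k - x j k : ℤ) : ZMod (2 * L + 1))).valMinAbs : ℤ)|) →
      ∀ T : Finset (Fin n),
        torusE (Matrix.specialUnitaryGroup (Fin N) ℂ) (fundamentalLatticeRep N) β L (fun U => Real.exp (∑ i ∈ T, (R : ℝ) ^ 4 / C₁ *
          |kerE (Matrix.specialUnitaryGroup (Fin N) ℂ) (fundamentalLatticeRep N) β (fun k => x i k - (R + 1)) (2 * R + 3) U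
            (plane (Matrix.specialUnitaryGroup (Fin N) ℂ) (fundamentalLatticeRep N) (q i) (x i)) - p (q i) β|)) ≤
          Real.exp ((A₀ + max B_Q (2 * Real.exp (2 * 1) * (1536 * (Δ₀ + D)))) * T.card) := by
  classical
  obtain ⟨K₀, D₁, hLF⟩ := torusE_exp_two_mul_sum_influence_le_of_windowCellLaws (N := N)
  obtain ⟨β₀, hβ₀⟩ := hδ₀ K₀ D₁
  refine ⟨max (max β₁ 1) β₀, ?_⟩
  refine responseMoments_of_quadratic_and_reducedLF (fundamentalLatticeRep N) a (β₁ := max (max β₁ 1) β₀)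
    Q (influenceAt (N := N) 𝔟 ε kmax) (fun β R q x => max (MQ β R q x) (coeffMass 𝔟 (kmax β R) R x)) hQm
    (fun β R q x η => (hQb β R q x η).trans (le_max_left _ _))
    (fun β R q x => measurable_influenceAt (N := N) 𝔟 ε kmax β R q x)
    (fun β R q x η => (abs_influenceAt_le (N := N) 𝔟 ε kmax β R q x η).trans (le_max_right _ _))
    (fun β hβ => hsplit β ((le_max_left _ _).trans ((le_max_left _ _).trans hβ)))
    (fun β hβ => hEMQ β ((le_max_left _ _).trans ((le_max_left _ _).trans hβ))) ?_
  intro β hβ L n q x R hq hR hRa hRL hred hsep T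
  have hβ₁ : β₁ ≤ β := (le_max_left _ _).trans ((le_max_left _ _).trans hβ)
  have hβ1 : 1 ≤ β := (le_max_right _ _).trans ((le_max_left _ _).trans hβ)
  have hββ₀ : β₀ ≤ β := (le_max_right _ _).trans hβ
  have hL : 1 ≤ L := by omega
  have h := hLF 𝔟 (ε β) (kmax β R) R L β hβ1 x hR hRL hred hsep (θ β) (δ β) (hθ0 β) (hθ1 β) (hδ0 β) (hδθ β)
    (fun k hk o A hAk hwin => hWCL β hβ₁ L hL k hk o A hAk hwin) T
  refine (le_of_eq ?_).trans (h.trans (Real.exp_le_exp.2 ?_))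
  · simp only [influenceAt_eq]
  · refine mul_le_mul_of_nonneg_right ?_ (Nat.cast_nonneg _)
    have h1 := hβ₀ β hββ₀
    have h2 := hD β hβ₁ R
    have h3 : 0 ≤ 2 * Real.exp (2 * 1) := by positivity
    exact mul_le_mul_of_nonneg_left (mul_le_mul_of_nonneg_left (add_le_add h1 h2) (by norm_num)) h3

end Button

/-! ## §4 At the registered stub (SU(2), fundamental representation, unit of record) -/

section Unit

/-- **The body of `stub_responseMomentsOdd6` from the (β) split, (EM_Q), a vanishing level-`0` activity and WINDOW CELL LAWS at the levels `k ≥ 1`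
with summable sixteenth roots of the activities.**  `SU(2)`, fundamental representation, unit `a ≤ c·uRec` eventually; conclusion = the registered body
with `B = A₀ + max(B_Q, 2e²·1536·(Δ₀ + D))`.  The lane-B supplier target of the (β) architecture, by name: `hWCL` + `hD` — one scale at a time,
grid-aligned non-wrapping families only, valid on every odd torus. [folklore] -/
theorem responseMomentsOdd6_of_quadratic_and_windowCellLaws {a : ℝ → ℝ} {c C₁ β₁ ℓ₁ A₀ B_Q D Δ₀ P₀ : ℝ}
    {p : Fin 4 × Fin 4 → ℝ → ℝ} (hc : 0 < c) (hle : ∀ᶠ β in atTop, a β ≤ c * Transport.uRec β) (hℓ₁ : 0 < ℓ₁)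
    (hC₁ : 0 < C₁) (hp : ∀ q β, |p q β| ≤ P₀) (𝔟 : BlockSize) (ε : ℝ → ℕ → ℝ) (kmax : ℝ → ℕ → ℕ)
    (Q : ℝ → ℕ → Fin 4 × Fin 4 → (Fin 4 → ℤ) → LGConfig 4 (Matrix.specialUnitaryGroup (Fin 2) ℂ) → ℝ)
    (MQ : ℝ → ℕ → Fin 4 × Fin 4 → (Fin 4 → ℤ) → ℝ)
    (hQm : ∀ β R q x, Measurable (Q β R q x)) (hQb : ∀ β R q x η, |Q β R q x η| ≤ MQ β R q x)
    (hsplit : ∀ β : ℝ, β₁ ≤ β → ∀ R : ℕ, 1 ≤ R → (R : ℝ) * a β ≤ ℓ₁ →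
      ∀ (q : Fin 4 × Fin 4) (x : Fin 4 → ℤ), q.1 < q.2 → ∀ η : LGConfig 4 (Matrix.specialUnitaryGroup (Fin 2) ℂ),
        (R : ℝ) ^ 4 / C₁ * |kerE (Matrix.specialUnitaryGroup (Fin 2) ℂ) (fundamentalLatticeRep 2) β (fun k => x k - (R + 1))
          (2 * R + 3) η (plane (Matrix.specialUnitaryGroup (Fin 2) ℂ) (fundamentalLatticeRep 2) q x) - p q β| ≤
          A₀ + Q β R q x η + influenceAt (N := 2) 𝔟 ε kmax β R q x η)
    (hEMQ : ∀ β : ℝ, β₁ ≤ β → ∀ (L n : ℕ) (q : Fin n → Fin 4 × Fin 4) (x : Fin n → (Fin 4 → ℤ)) (R : ℕ),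
      (∀ i, (q i).1 < (q i).2) → 1 ≤ R → (R : ℝ) * a β ≤ ℓ₁ → 4 * R + 8 ≤ L →
      (∀ i j : Fin n, i ≠ j → ∃ k : Fin 4,
        (2 * (R : ℤ) + 4) ≤ |((((x i k - x j k : ℤ) : ZMod (2 * L + 1))).valMinAbs : ℤ)|) →
      ∀ T : Finset (Fin n),
        torusE (Matrix.specialUnitaryGroup (Fin 2) ℂ) (fundamentalLatticeRep 2) β L
          (fun U => Real.exp (((2 : ℕ) : ℝ) * ∑ i ∈ T, Q β R (q i) (x i) U)) ≤ Real.exp (B_Q * T.card))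
    (hδ₀ : ∀ (K₀ : ℝ) (D₁ : ℕ), ∃ β₀ : ℝ, ∀ β : ℝ, β₀ ≤ β →
      Real.exp (-(β * ((2 : ℕ) * ε β 0 : ℝ)) / Fintype.card (Orient 4) + (K₀ + D₁ * Real.log β) / Fintype.card (Orient 4)) ≤ Δ₀)
    (θ δ : ℝ → ℕ → ℝ) (hθ0 : ∀ β k, 0 ≤ θ β k) (hθ1 : ∀ β k, θ β k ≤ 1) (hδ0 : ∀ β k, 0 ≤ δ β k)
    (hδθ : ∀ β k, δ β k ≤ θ β k ^ 16)
    (hWCL : ∀ β : ℝ, β₁ ≤ β → ∀ L : ℕ, 1 ≤ L → ∀ k : ℕ, 1 ≤ k → ∀ (o : Fin 4 → ℤ) (A : Finset Polymer),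
      (∀ γ ∈ A, γ.k = k) → (∀ γ ∈ A, ∀ c, o c ≤ anchor 𝔟 γ c ∧ anchor 𝔟 γ c + (𝔟.b : ℤ) ^ k ≤ o c + (2 * L + 1)) →
      torusE (Matrix.specialUnitaryGroup (Fin 2) ℂ) (fundamentalLatticeRep 2) β L (fun U => ∏ γ ∈ A,
        (largeFieldEvent (N := 2) 𝔟 (ε β k) γ).indicator (fun _ => (1 : ℝ)) U) ≤ ∏ _γ ∈ A, δ β k)
    (hD : ∀ β : ℝ, β₁ ≤ β → ∀ R : ℕ, ∑ k ∈ (Finset.range (kmax β R + 1)).filter (fun k => 1 ≤ k), θ β k ≤ D) :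
    ∃ (a : ℝ → ℝ) (c : ℝ) (C₁ B β₁ ℓ₁ P₀ : ℝ) (p : Fin 4 × Fin 4 → ℝ → ℝ), 0 < c ∧
      (∀ᶠ β in atTop, a β ≤ c * Transport.uRec β) ∧ 0 < ℓ₁ ∧ 0 < C₁ ∧ (∀ q β, |p q β| ≤ P₀) ∧
      ∀ β : ℝ, β₁ ≤ β → ∀ (L n : ℕ) (q : Fin n → Fin 4 × Fin 4) (x : Fin n → (Fin 4 → ℤ)) (R : ℕ),
        (∀ i, (q i).1 < (q i).2) → 1 ≤ R → (R : ℝ) * a β ≤ ℓ₁ → 4 * R + 8 ≤ L →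
        (∀ i j : Fin n, i ≠ j → ∃ k : Fin 4,
          (2 * (R : ℤ) + 4) ≤ |((((x i k - x j k : ℤ) : ZMod (2 * L + 1))).valMinAbs : ℤ)|) →
        ∀ T : Finset (Fin n),
          torusE (Matrix.specialUnitaryGroup (Fin 2) ℂ) (fundamentalLatticeRep 2) β L
            (fun U => Real.exp (∑ i ∈ T, (R : ℝ) ^ 4 / C₁ *
              |kerE (Matrix.specialUnitaryGroup (Fin 2) ℂ) (fundamentalLatticeRep 2) β (fun k => x i k - (R + 1)) (2 * R + 3) U
                (plane (Matrix.specialUnitaryGroup (Fin 2) ℂ) (fundamentalLatticeRep 2) (q i) (x i)) - p (q i) β|)) ≤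
            Real.exp (B * T.card) := by
  obtain ⟨β₁', h⟩ := responseMoments_of_quadratic_and_windowCellLaws (N := 2) a 𝔟 ε kmax Q MQ hQm hQb hsplit hEMQ
    (by simpa using hδ₀) θ δ hθ0 hθ1 hδ0 hδθ hWCL hD
  exact ⟨a, c, C₁, A₀ + max B_Q (2 * Real.exp (2 * 1) * (1536 * (Δ₀ + D))), β₁', ℓ₁, P₀, p, hc, hle, hℓ₁, hC₁, hp, h⟩

end Unit

end Summit.QuantumFields.YangMills.Cruxes.UVSeamRec.TemperedResponse

end
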